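import Summits.AtomisticToContinuum.FouriersLaw.Theses.HoelderEscapeProfile
import Summits.AtomisticToContinuum.FouriersLaw.Theorems.EmbeddedDrudeMourreMourreDissolutionGibbsMixing
import Literature.MathematicalPhysics.KineticTheory.TransportRegularityOfMixing
import Literature.MathematicalPhysics.KineticTheory.InfiniteChainClusteringTransfer
import Literature.MathematicalPhysics.KineticTheory.InfiniteChainL2Locality
import Literature.MathematicalPhysics.KineticTheory.InfiniteChainGeneratorLipschitz
import Literature.MathematicalPhysics.KineticTheory.InfiniteChainTwoPointContinuity
import Literature.MathematicalPhysics.KineticTheory.InfiniteChainSeveredGibbs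
import Literature.MathematicalPhysics.KineticTheory.InfiniteChainGibbsInvariance
import Literature.MathematicalPhysics.KineticTheory.InfiniteChainShiftInvariantUniqueness
import Literature.MathematicalPhysics.KineticTheory.InfiniteChainPartialMomentumReversal
import Literature.MathematicalPhysics.KineticTheory.InfiniteChainCurrentMoments
import Literature.MathematicalPhysics.KineticTheory.InfiniteChainCorrelationContinuity
import Literature.MathematicalPhysics.KineticTheory.InfiniteChainCurrentPositiveType
import Literature.MathematicalPhysics.KineticTheory.InfiniteChainSuperstableOrbits
import Literature.MathematicalPhysics.KineticTheory.InfiniteChainEnergyDensityMoments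
import Literature.MathematicalPhysics.KineticTheory.InfiniteChainOrbitEnergyFlux

/-!
# Line `Sketch` (canonical reduction) for crux `FibreCalculus` (stmt-AtomisticToContinuum-16011)

Route `HoelderEscapeProfile` (sub-problem `FouriersLaw`), crux r7 `FibreCalculus`: the twelve-clause infinite-volume
fibre calculus of the Abel escape profile for EVERY guarded arena `(μ, D)` of the pinned chain
`pinnedChain ω₂ lam β γ` (`ω₂, lam, β > 0`, `T > 0`, `μ` a shift- and momentum-reversal-invariant DLR state,
`D` a `μ`-preserving `InfiniteChainDynamics` with a.e. shift-covariant flow).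

## The lever: dynamics rigidity (the `∀ D` quantifier is removed first)

Every `μ`-preserving `D` coincides `μ`-a.e., AT ALL TIMES, with the canonical Buttà–Marchioro dynamics `D♭` of
`OscillatorChain.exists_bmDynamics` (carrier `bmGood`, measurable flow, identity off `bmGood`): superstability of the
shift-invariant DLR state (`hasSuperstabilityEstimate_of_isShiftInvariant_pinnedChain`), sup-in-time BM (2.6)
(`ae_forall_flow_mem_bmGood_pinnedChain`) and the `unique` field of `D♭` (`flow_ae_eq_canonical` below, PROVED).
All twelve clauses see `D` only through the two-point functions `S(x,t)`, `G(x,t)`, `C_T = Σ_x G(x,·)` and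
`HasAbsConvergentCorrelation`, which are blind to a.e. modification of `φ_t`; so the crux is a statement about the
single pair `(μ, D♭)`, for which every light-cone / clustering / positive-type / continuity theorem of the tree is
stated. The stubs below are therefore either statements about the CANONICAL class
(`D.carrier = bmGood`, `Measurable (D.flow t)`, `D.flow t = id` off `bmGood`) or pure analysis.

## Stubs (`sorry` lives ONLY in them)

* `stub_staticStructureFactor` (A, statics; verbatim the registered stub of `Lines/birth.lean`): clauses (5), (6).
* `stub_polynomialHorizonCone` (W1, HARDEST — the lead's): `L²` locality of `a ∘ φ_t` for the canonical dynamics with a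
  `(1+n)²`-summable rate whose weighted sum is POLYNOMIAL in the time window (the tree's `exists_summable_l2_locality`
  re-run with its constants kept).
* `stub_weightedClusteringTransfer` (W2, abstract measure theory): the clustering transfer
  `exists_summable_majorant_covariance_comp_chainShift` with the `(1+x²)` weight and an explicit dependence on
  `Σ_n (1+n)² ε_n`.
* `stub_twiceIntegratedContinuity` (P): the twice-integrated local conservation law
  `S(x,t) − S(x,0) = ∫₀ᵗ (t−u) (Δ_x G)(x,u) du` for the canonical dynamics (pathwise `ḣ_x = j_{x−1} − j_x`, Fubini,
  stationarity, momentum reversal, shift covariance).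
* `stub_bochnerPositivity` (B, reshaped to the canonical class): `f̂_ν ≥ 0` from positive-definiteness of
  `x ↦ S̄_ν(x)` (Abel mean of an autocorrelation `≥ 0`) and Fejér.
* `stub_conservationLawIdentities` (I, reshaped to PURE ANALYSIS): clauses (11), (12) from (P), the Laplace calculus of
  `t ↦ ∫₀ᵗ(t−u)F(u)du`, and lattice Fourier algebra, for ARBITRARY `S, G : ℤ → ℝ → ℝ` with the listed regularity.

## Composition `FibreCalculus_of` (kernel-checked, no `sorry`)

rigidity ⇒ `S, G` of `D` are those of `D♭`; W1 (for `h₀`, `j₀`) + W2 (for the ρ-mixing transfer-operator state, which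
`μ` IS by DLR uniqueness) ⇒ `Σ_x (1+x²)(|S(x,t)| + |G(x,t)|) ≤ A(1+|t|)^m` with window majorants ⇒ clauses (1), (2),
(3), (4), (10) (+ continuity by the Weierstrass M-test, two-point continuity in tree); A ⇒ (5), (6); B ⇒ (8);
P + I ⇒ (11), (12); (7) = (11) at `k = 0`; (9) = Parseval `integral_cosSeries_eq` from (4).
-/

noncomputable section

open MeasureTheory ProbabilityTheory Filter Topology Set Function

namespace Summit.AtomisticToContinuum.FouriersLaw.Cruxes.FibreCalculus.CanonicalReduction

open Literature.MathematicalPhysics.KineticTheory.HeatConduction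
open Summit.AtomisticToContinuum.FouriersLaw.Theses.HoelderEscapeProfile (FibreCalculus)

/-! ### The registered stubs (`sorry` lives ONLY here) -/

/-- STUB A `stub_staticStructureFactor` (size M; statics of the DLR state; SHARED VERBATIM with `Lines/birth.lean`) —
for the split-bond site energy `h_x = p_x²/2 + U(q_x) + (V(q_(x+1)−q_x) + V(q_x−q_(x−1)))/2` and its STATIC covariance
`S₀(x) = ∫(h_0 − ⟨h_0⟩)(h_x − ⟨h_0⟩)dμ`: `Σ_x (1+x²)|S₀(x)| < ∞` (exponential ρ-mixing of the unique shift-invariant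
DLR state = transfer-operator state, `Theorems.MourreDissolution.exists_gibbsState_mixing_pinnedChain` +
`eq_of_isChainGibbsMeasure_of_isShiftInvariant_pinnedChain`) and `0 < Σ_x S₀(x)` (`≥ T²/2`: the momenta are i.i.d.
`N(0,T)` independent of the positions in a DLR state, so `Σ_x S₀(x) = Var(p²/2) + Σ_x Cov(c_0,c_x)` with `c_x` the
configurational part, and the configurational asymptotic variance is `≥ 0` by Fejér). No dynamics enters.
[cite: Georgii2011, Thm 10.25 and §11.1] [cite: BonettoLebowitzReyBellet2000, §7] -/
theorem stub_staticStructureFactor :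
    ∀ ω₂ lam β γ : ℝ, 0 < ω₂ → 0 < lam → 0 < β → ∀ T : ℝ, 0 < T →
    ∀ μ : Measure ChainConfig, (pinnedChain ω₂ lam β γ).IsChainGibbsMeasure T μ → IsShiftInvariant μ →
    μ.map (fun σ : ChainConfig => fun x : ℤ => ((σ x).1, -(σ x).2)) = μ →
    ∀ h : ChainConfig → ℤ → ℝ,
      h = (fun (σ : ChainConfig) (x : ℤ) => (σ x).2 ^ 2 / 2 + (pinnedChain ω₂ lam β γ).U (σ x).1 +
        ((pinnedChain ω₂ lam β γ).V ((σ (x + 1)).1 - (σ x).1) +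
          (pinnedChain ω₂ lam β γ).V ((σ x).1 - (σ (x - 1)).1)) / 2) →
    ∀ S₀ : ℤ → ℝ,
      S₀ = (fun x : ℤ => ∫ σ, (h σ 0 - ∫ σ', h σ' 0 ∂μ) * (h σ x - ∫ σ', h σ' 0 ∂μ) ∂μ) →
    Summable (fun x : ℤ => (1 + (x : ℝ) ^ 2) * |S₀ x|) ∧ 0 < ∑' x : ℤ, S₀ x := by
  sorry

/-- STUB W1 `stub_polynomialHorizonCone` (size L; HARDEST — the POLYNOMIAL-HORIZON WEIGHTED `L²` LIGHT CONE of the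
canonical dynamics). For the pinned chain, a shift-invariant DLR state `μ` (superstable), a dynamics `D` of the
canonical class (carrier `bmGood`, measurable flow) and a measurable observable `a` depending on the sites `−1, 0, 1`,
in `L²` and `L⁴`, polynomially Lipschitz in those coordinates (the format `ha` of
`InfiniteChainDynamics.exists_abs_sub_comp_severedFlow_le`; e.g. `h₀`, `j₀` by `exists_polyLipschitz_energyDensityZ /
_bondCurrentZ`): there are `A, m` such that for every window `τ ≥ 0` there is a rate `ε ≥ 0` with
`Σ_n (1+n)² ε_n ≤ A(1+τ)^m` and, for all `|t| ≤ τ` and `n`, an observable localised in `[−n−1, n+1]` (the severed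
approximant `a ∘ T^{Λ_{0,n}}_t`) within `ε_n` of `a ∘ φ_t` in `L²(μ)`. Mechanism: the proof of
`exists_summable_l2_locality` with its constants kept — threshold `n₀(τ) = O((1+τ)³)`, rate
`Cb(τ) n^{2d+1} 32^{−n} + Cη e^{−λ₀ n/(8c(τ))}` with `c(τ) = A₀(1+τ²(1+τ))`, `Cb` linear in `τ`, so
`Σ_n (1+n)²ε_n ≤ E₀ n₀³ + O(1+τ) + O(c(τ)³)`. [cite: ButtaMarchioro2016, §3 eqs. (3.7), (3.14)–(3.16) and §2 eq. (2.6)] -/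
theorem stub_polynomialHorizonCone :
    ∀ ω₂ lam β γ : ℝ, 0 < ω₂ → 0 < lam → 0 < β → ∀ T : ℝ, 0 < T →
    ∀ μ : Measure ChainConfig, (pinnedChain ω₂ lam β γ).IsChainGibbsMeasure T μ → IsShiftInvariant μ →
    ∀ D : InfiniteChainDynamics (pinnedChain ω₂ lam β γ),
    D.carrier = (pinnedChain ω₂ lam β γ).bmGood → (∀ t : ℝ, Measurable (D.flow t)) →
    ∀ a : ChainConfig → ℝ, Measurable a → DependsOn a (Set.Icc (-1 : ℤ) 1) → MemLp a 2 μ →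
    Integrable (fun σ => a σ ^ 4) μ →
    ∀ (Ca : ℝ) (da : ℕ), 0 ≤ Ca →
    (∀ (σ σ' : ChainConfig) (R δ : ℝ), 1 ≤ R → 0 ≤ δ → δ ≤ 1 →
      (∀ i : ℤ, -1 ≤ i → i ≤ 1 → |(σ' i).1| ≤ R ∧ |(σ' i).2| ≤ R ∧
        |(σ i).1 - (σ' i).1| ≤ δ ∧ |(σ i).2 - (σ' i).2| ≤ δ) → |a σ - a σ'| ≤ Ca * R ^ da * δ) →
    ∃ (A : ℝ) (m : ℕ), ∀ τ : ℝ, 0 ≤ τ → ∃ ε : ℕ → ℝ, (∀ n, 0 ≤ ε n) ∧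
      Summable (fun n : ℕ => (1 + (n : ℝ)) ^ 2 * ε n) ∧
      (∑' n : ℕ, (1 + (n : ℝ)) ^ 2 * ε n) ≤ A * (1 + τ) ^ m ∧
      ∀ t : ℝ, |t| ≤ τ → ∀ n : ℕ, ∃ g : ChainConfig → ℝ,
        DependsOn g (Set.Icc (-(n : ℤ) - 1) (n + 1)) ∧ Measurable g ∧ MemLp g 2 μ ∧
        Real.sqrt (∫ σ, (a (D.flow t σ) - g σ) ^ 2 ∂μ) ≤ ε n := by
  sorry

/-- STUB W2 `stub_weightedClusteringTransfer` (size M; abstract measure theory on `ChainConfig`, no dynamics) — the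
clustering transfer `exists_summable_majorant_covariance_comp_chainShift` with SECOND MOMENTS: under exponential
ρ-mixing between half-lines (constant `C`, rate `m > 0`) and translation invariance of a probability measure `μ`, for
a box-local square-integrable `a` (sites in `[−R, R]`), a margin `K` and a level `Gb ≥ 0` there is `B` such that for
every rate `ε ≥ 0` with `Σ_n (1+n)²ε_n < ∞` the explicit majorant
`F x = max C 1 · ‖a‖₂ (Gb + ε(|x|/2)) e^{−m(|x| − |x|/2 − K − R)₊} + ‖a‖₂ ε(|x|/2)` of that theorem satisfies
`Σ_x (1+x²) F x ≤ B (1 + Σ_n (1+n)² ε_n)` and bounds `|Cov_μ(a, g ∘ τ_x)|` for every measurable `g` with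
`‖g‖₂ ≤ Gb` admitting `[−(n+K), n+K]`-local approximants within `ε_n`. (`Σ_x (1+x²)ε(|x|/2) ≤ 16 Σ_n (1+n)²ε_n`;
`Σ_x (1+x²)e^{−m(|x|/2 − K − R)₊} < ∞`.) [folklore] -/
theorem stub_weightedClusteringTransfer :
    ∀ μ : Measure ChainConfig, IsProbabilityMeasure μ → ∀ (C m : ℝ), 0 < m →
    (∀ (p : ℤ) (n : ℕ) (f g : ChainConfig → ℝ),
      DependsOn f {i : ℤ | i ≤ p} → DependsOn g {i : ℤ | p + n ≤ i} →
      Measurable f → Measurable g → MemLp f 2 μ → MemLp g 2 μ →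
      |MeasureTheory.integral μ (fun σ => f σ * g σ) -
          MeasureTheory.integral μ f * MeasureTheory.integral μ g| ≤
        C * Real.exp (-(m * n)) * (MeasureTheory.integral μ (fun σ => f σ ^ 2)) ^ (1 / 2 : ℝ) *
          (MeasureTheory.integral μ (fun σ => g σ ^ 2)) ^ (1 / 2 : ℝ)) →
    (∀ x : ℤ, MeasurePreserving (chainShift x) μ μ) →
    ∀ (a : ChainConfig → ℝ) (R : ℕ), DependsOn a (Set.Icc (-(R : ℤ)) R) → Measurable a → MemLp a 2 μ →
    ∀ (K : ℕ) (Gb : ℝ), 0 ≤ Gb →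
    ∃ B : ℝ, ∀ ε : ℕ → ℝ, (∀ n, 0 ≤ ε n) → Summable (fun n : ℕ => (1 + (n : ℝ)) ^ 2 * ε n) →
      ∃ F : ℤ → ℝ, Summable (fun x : ℤ => (1 + (x : ℝ) ^ 2) * F x) ∧
        (∑' x : ℤ, (1 + (x : ℝ) ^ 2) * F x) ≤ B * (1 + ∑' n : ℕ, (1 + (n : ℝ)) ^ 2 * ε n) ∧
        ∀ g : ChainConfig → ℝ, Measurable g → MemLp g 2 μ → Real.sqrt (∫ σ, g σ ^ 2 ∂μ) ≤ Gb →
          (∀ n : ℕ, ∃ h : ChainConfig → ℝ, DependsOn h (Set.Icc (-((n + K : ℕ) : ℤ)) (n + K : ℕ)) ∧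
            Measurable h ∧ MemLp h 2 μ ∧ Real.sqrt (∫ σ, (g σ - h σ) ^ 2 ∂μ) ≤ ε n) →
          ∀ x : ℤ, |ProbabilityTheory.covariance a (g ∘ chainShift x) μ| ≤ F x := by
  sorry

/-- STUB P `stub_twiceIntegratedContinuity` (size M–L; the twice-integrated local conservation law for the canonical
dynamics). For the pinned chain, a shift- and momentum-reversal-invariant DLR state `μ` and `D` of the canonical class:
with `h_x` the split-bond energy density (`energyDensityZ`), `S(x,t) = ∫(h_0 − ⟨h_0⟩)(h_x∘φ_t − ⟨h_0⟩)dμ` and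
`G(x,t) = ∫ j_0 (j_x∘φ_t) dμ`: `S(x,t) − S(x,0) = ∫_{(0,t]} (t−u)(G(x+1,u) − 2G(x,u) + G(x−1,u)) du` for `t ≥ 0`.
Mechanism: pathwise `h_x(φ_tσ) − h_x(σ) = ∫₀ᵗ (j_{x−1} − j_x)(φ_sσ) ds` on the carrier
(`IsSolution.hasDerivAt_energyDensityZ`, FTC); Fubini (joint measurability by Carathéodory on a measurable full-measure
part of the carrier, as in `integral_Ioc_sub_mul_nonneg`); `K(y,s) := ∫ h̃_0 (j_y∘φ_s) = ∫ (h̃_0∘φ_{−s}) j_y`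
(invariance + group law `flow_add_of_eq_id`); the same FTC for `h̃_0∘φ_{−s}`; `∫ j_{−1}(j_y∘φ_u) = G(y+1,u)` (shift
invariance + `flow_chainShift_of_eq_id`), `K(y,0) = Cov(h_0, j_y) = 0` (momentum reversal: `h` even, `j` odd); finally
`∫₀ᵗ∫₀ˢ F = ∫₀ᵗ (t−u)F(u)du` (`integral_Ioc_integral_Ioc_sub_eq`). [cite: BonettoLebowitzReyBellet2000, §5.2 eq. (23)]
[cite: Helfand1960] -/
theorem stub_twiceIntegratedContinuity :
    ∀ ω₂ lam β γ : ℝ, 0 < ω₂ → 0 < lam → 0 < β → ∀ T : ℝ, 0 < T →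
    ∀ μ : Measure ChainConfig, (pinnedChain ω₂ lam β γ).IsChainGibbsMeasure T μ → IsShiftInvariant μ →
    μ.map (fun σ : ChainConfig => fun x : ℤ => ((σ x).1, -(σ x).2)) = μ →
    ∀ D : InfiniteChainDynamics (pinnedChain ω₂ lam β γ),
    D.carrier = (pinnedChain ω₂ lam β γ).bmGood → (∀ t : ℝ, Measurable (D.flow t)) →
    (∀ t : ℝ, ∀ σ ∉ (pinnedChain ω₂ lam β γ).bmGood, D.flow t σ = σ) →
    ∀ h : ChainConfig → ℤ → ℝ,
      h = (fun (σ : ChainConfig) (x : ℤ) => (σ x).2 ^ 2 / 2 + (pinnedChain ω₂ lam β γ).U (σ x).1 +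
        ((pinnedChain ω₂ lam β γ).V ((σ (x + 1)).1 - (σ x).1) +
          (pinnedChain ω₂ lam β γ).V ((σ x).1 - (σ (x - 1)).1)) / 2) →
    ∀ S : ℤ → ℝ → ℝ,
      S = (fun (x : ℤ) (t : ℝ) =>
        ∫ σ, (h σ 0 - ∫ σ', h σ' 0 ∂μ) * (h (D.flow t σ) x - ∫ σ', h σ' 0 ∂μ) ∂μ) →
    ∀ G : ℤ → ℝ → ℝ,
      G = (fun (x : ℤ) (t : ℝ) => ∫ σ, (pinnedChain ω₂ lam β γ).bondCurrentZ σ 0 *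
        (pinnedChain ω₂ lam β γ).bondCurrentZ (D.flow t σ) x ∂μ) →
    ∀ (x : ℤ) (t : ℝ), 0 ≤ t →
      S x t - S x 0 = ∫ u in Set.Ioc (0:ℝ) t, (t - u) * (G (x + 1) u - 2 * G x u + G (x - 1) u) := by
  sorry

/-- STUB B `stub_bochnerPositivity` (size M; positive type, RESHAPED to the canonical class with the temperedness it
needs as hypotheses) — for the canonical dynamics in the shift-invariant DLR state, if `t ↦ e^(−νt)S(x,t)` is
integrable on `(0,∞)` for all `x` and `x ↦ S̄_ν(x)` is absolutely summable, then
`f̂_ν(k) = Σ_x cos(kx)S̄_ν(x) ≥ 0` for all `ν > 0`, `k`. Mechanism: (i) `x ↦ S̄_ν(x)` is POSITIVE-DEFINITE on `ℤ`: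
for a finite real family `c`, `Σ_{x,y} c_x c_y S̄_ν(x−y) = ν∫₀^∞e^(−νt) Cov(g, g∘φ_t)dt` with `g = Σ_x c_x h_x`
(`S(x−y,t) = Cov(h_y, h_x∘φ_t)` by shift invariance of `μ` and `flow_chainShift_of_eq_id`), and the Abel mean of the
autocorrelation `F(t) = ∫ g̃ (g̃∘φ_t)dμ` (continuous, `|F| ≤ F(0)`) is `≥ 0` because
`∫e^(−νt)F = ν²∫e^(−νt)(∫_{(0,t]}(t−u)F(u)du)dt` (two integrations by parts, cf. `laplaceHeatVariance` of the sibling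
workfile `Cruxes/HeatVarianceCalculus/HeatVarianceCalculusComplete.lean`) and `∫_{(0,t]}(t−u)F(u)du ≥ 0`
(`InfiniteChainDynamics.integral_Ioc_sub_mul_nonneg`, `g̃` continuous along orbits by `continuous_energyDensityZ_flow`);
(ii) FEJÉR: with `c_x = cos(kx)`, `c_x = sin(kx)` on `[−L, L]`,
`0 ≤ (2L+1)⁻¹ Σ_{|x|,|y|≤L} cos(k(x−y)) S̄_ν(x−y) = Σ_z (1 − |z|/(2L+1))₊ cos(kz) S̄_ν(z) → f̂_ν(k)` (dominated
convergence, `Σ|S̄_ν| < ∞`); evenness of `S̄_ν` is not needed. [cite: BonettoLebowitzReyBellet2000, §7] [cite: Helfand1960] -/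
theorem stub_bochnerPositivity :
    ∀ ω₂ lam β γ : ℝ, 0 < ω₂ → 0 < lam → 0 < β → ∀ T : ℝ, 0 < T →
    ∀ μ : Measure ChainConfig, (pinnedChain ω₂ lam β γ).IsChainGibbsMeasure T μ → IsShiftInvariant μ →
    μ.map (fun σ : ChainConfig => fun x : ℤ => ((σ x).1, -(σ x).2)) = μ →
    ∀ D : InfiniteChainDynamics (pinnedChain ω₂ lam β γ),
    D.carrier = (pinnedChain ω₂ lam β γ).bmGood → (∀ t : ℝ, Measurable (D.flow t)) →
    (∀ t : ℝ, ∀ σ ∉ (pinnedChain ω₂ lam β γ).bmGood, D.flow t σ = σ) →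
    ∀ h : ChainConfig → ℤ → ℝ,
      h = (fun (σ : ChainConfig) (x : ℤ) => (σ x).2 ^ 2 / 2 + (pinnedChain ω₂ lam β γ).U (σ x).1 +
        ((pinnedChain ω₂ lam β γ).V ((σ (x + 1)).1 - (σ x).1) +
          (pinnedChain ω₂ lam β γ).V ((σ x).1 - (σ (x - 1)).1)) / 2) →
    ∀ S : ℤ → ℝ → ℝ,
      S = (fun (x : ℤ) (t : ℝ) =>
        ∫ σ, (h σ 0 - ∫ σ', h σ' 0 ∂μ) * (h (D.flow t σ) x - ∫ σ', h σ' 0 ∂μ) ∂μ) →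
    ∀ Sb : ℝ → ℤ → ℝ,
      Sb = (fun (ν : ℝ) (x : ℤ) => ν * ∫ t in Set.Ioi (0:ℝ), Real.exp (-(ν * t)) * S x t) →
    (∀ x : ℤ, ∀ ν : ℝ, 0 < ν →
      IntegrableOn (fun t : ℝ => Real.exp (-(ν * t)) * S x t) (Set.Ioi 0)) →
    (∀ ν : ℝ, 0 < ν → Summable (fun x : ℤ => |Sb ν x|)) →
    ∀ fh : ℝ → ℝ → ℝ, fh = (fun (ν k : ℝ) => ∑' x : ℤ, Real.cos (k * (x : ℝ)) * Sb ν x) →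
    ∀ ν : ℝ, 0 < ν → ∀ k : ℝ, 0 ≤ fh ν k := by
  sorry

/-- STUB I `stub_conservationLawIdentities` (size M–L; PURE REAL ANALYSIS, RESHAPED — no dynamics: `S`, `G` are
arbitrary functions `ℤ → ℝ → ℝ` with the listed regularity) — from the twice-integrated conservation law (output of
stub P), continuity, a uniform bound and a polynomially weighted `ℓ¹` bound of `G`, and the temperedness of `S`
(clauses (3), (4), (5)): (11) the k-SPACE CONSERVATION LAW `χ(k) − f̂_ν(k) = (2−2cos k)𝒢_ν(k)/ν` and (12)
HELFAND–ABEL `∫₀^∞e^(−νt)Σ_xG(x,t)dt = (ν/2)(Σ_x x²S̄_ν(x) − Σ_x x²S(x,0))`. Mechanism: for each `x` the Laplace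
calculus of `V(t) = ∫_{(0,t]}(t−u)F(u)du` (`∫e^(−νt)V = ν⁻²∫e^(−νt)F`, continuous bounded `F = Δ_xG(x,·)`; cf.
`laplaceHeatVariance` of `Cruxes/HeatVarianceCalculus/HeatVarianceCalculusComplete.lean`) gives the POINTWISE ABEL LAW
`S̄_ν(x) − S(x,0) = ν⁻¹(L(x+1) − 2L(x) + L(x−1))`, `L(x) = ∫₀^∞e^(−νt)G(x,t)dt` (`Σ_x(1+x²)|L(x)| < ∞`); its cosine
transform is (11) (`Σ_x cos(kx)(L(x+1)+L(x−1)) = 2cos k Σ_x cos(kx)L(x)` by reindexing — the sine terms cancel — and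
`𝒢_ν(k) = Σ_x cos(kx)L(x)` by `integral_tsum` with the weighted bound); its `x²`-moment is (12)
(`Σ_x x²Δa(x) = 2Σ_x a(x)`). [cite: Helfand1960] [cite: BonettoLebowitzReyBellet2000, §7 eq. (37)] -/
theorem stub_conservationLawIdentities :
    ∀ (S G : ℤ → ℝ → ℝ),
    (∀ x : ℤ, Continuous (G x)) →
    (∃ M : ℝ, ∀ (x : ℤ) (t : ℝ), |G x t| ≤ M) →
    (∃ (A : ℝ) (m : ℕ), ∀ t : ℝ, Summable (fun x : ℤ => (1 + (x : ℝ) ^ 2) * |G x t|) ∧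
      (∑' x : ℤ, (1 + (x : ℝ) ^ 2) * |G x t|) ≤ A * (1 + |t|) ^ m) →
    (∀ (x : ℤ) (t : ℝ), 0 ≤ t →
      S x t - S x 0 = ∫ u in Set.Ioc (0:ℝ) t, (t - u) * (G (x + 1) u - 2 * G x u + G (x - 1) u)) →
    (∀ x : ℤ, ∀ ν : ℝ, 0 < ν →
      IntegrableOn (fun t : ℝ => Real.exp (-(ν * t)) * S x t) (Set.Ioi 0)) →
    ∀ Sb : ℝ → ℤ → ℝ,
      Sb = (fun (ν : ℝ) (x : ℤ) => ν * ∫ t in Set.Ioi (0:ℝ), Real.exp (-(ν * t)) * S x t) →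
    (∀ ν : ℝ, 0 < ν → Summable (fun x : ℤ => (1 + (x : ℝ) ^ 2) * |Sb ν x|)) →
    Summable (fun x : ℤ => (1 + (x : ℝ) ^ 2) * |S x 0|) →
    ∀ Gh : ℝ → ℝ → ℝ,
      Gh = (fun (ν k : ℝ) =>
        ∫ t in Set.Ioi (0:ℝ), Real.exp (-(ν * t)) * ∑' x : ℤ, Real.cos (k * (x : ℝ)) * G x t) →
    ∀ fh : ℝ → ℝ → ℝ, fh = (fun (ν k : ℝ) => ∑' x : ℤ, Real.cos (k * (x : ℝ)) * Sb ν x) →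
    ∀ χk : ℝ → ℝ, χk = (fun k : ℝ => ∑' x : ℤ, Real.cos (k * (x : ℝ)) * S x 0) →
    (∀ ν : ℝ, 0 < ν → ∀ k : ℝ, χk k - fh ν k = (2 - 2 * Real.cos k) * Gh ν k / ν) ∧
    (∀ ν : ℝ, 0 < ν → ∫ t in Set.Ioi (0:ℝ), Real.exp (-(ν * t)) * ∑' x : ℤ, G x t =
      ν / 2 * ((∑' x : ℤ, (x : ℝ) ^ 2 * Sb ν x) - ∑' x : ℤ, (x : ℝ) ^ 2 * S x 0)) := by
  sorry

/-! ### By-name statements of the registered stubs -/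

namespace Registered

/-- Statement of registered stub A (`stub_staticStructureFactor`), by name. -/
def stub_staticStructureFactor : Prop := type_of% CanonicalReduction.stub_staticStructureFactor

/-- Statement of registered stub W1 (`stub_polynomialHorizonCone`), by name. -/
def stub_polynomialHorizonCone : Prop := type_of% CanonicalReduction.stub_polynomialHorizonCone

/-- Statement of registered stub W2 (`stub_weightedClusteringTransfer`), by name. -/
def stub_weightedClusteringTransfer : Prop := type_of% CanonicalReduction.stub_weightedClusteringTransfer

/-- Statement of registered stub P (`stub_twiceIntegratedContinuity`), by name. -/
def stub_twiceIntegratedContinuity : Prop := type_of% CanonicalReduction.stub_twiceIntegratedContinuity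

/-- Statement of registered stub B (`stub_bochnerPositivity`), by name. -/
def stub_bochnerPositivity : Prop := type_of% CanonicalReduction.stub_bochnerPositivity

/-- Statement of registered stub I (`stub_conservationLawIdentities`), by name. -/
def stub_conservationLawIdentities : Prop := type_of% CanonicalReduction.stub_conservationLawIdentities

end Registered

/-! ### Plumbing (no `sorry`): rigidity, Laplace bookkeeping, M-test, Parseval -/

/-- **Dynamics rigidity.** For the pinned chain (`ω₂, lam, β > 0`), a shift-invariant DLR state `μ` at `T > 0`, ANY
dynamics `D` preserving `μ` and ANY dynamics `D'` whose carrier is BM's good set: `μ`-a.e. orbit of `D` is the orbit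
of `D'`, simultaneously for all times (superstability of the shift-invariant state, sup-in-time BM (2.6)
`ae_forall_flow_mem_bmGood_pinnedChain`, the uniqueness field of `D'`; as in the sibling workfile
`Cruxes/HeatVarianceCalculus/HeatVarianceCalculusComplete.lean`). [folklore] -/
theorem flow_ae_eq_canonical {ω₂ lam β : ℝ} (γ : ℝ) (hω : 0 < ω₂) (hl : 0 < lam) (hβ : 0 < β)
    {T : ℝ} (hT : 0 < T) {μ : Measure ChainConfig}
    (hG : (pinnedChain ω₂ lam β γ).IsChainGibbsMeasure T μ) (hSI : IsShiftInvariant μ)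
    (D D' : InfiniteChainDynamics (pinnedChain ω₂ lam β γ)) (hP : D.PreservesMeasure μ)
    (hcar : D'.carrier = (pinnedChain ω₂ lam β γ).bmGood) :
    ∀ᵐ σ ∂μ, ∀ t : ℝ, D.flow t σ = D'.flow t σ := by
  have hss : (pinnedChain ω₂ lam β γ).HasSuperstabilityEstimate μ :=
    OscillatorChain.hasSuperstabilityEstimate_of_isShiftInvariant_pinnedChain γ hω hl.le hβ.le hT hG hSI
  have hgood := OscillatorChain.ae_forall_flow_mem_bmGood_pinnedChain γ hω.le hl hβ hss D hP
  filter_upwards [hP.1, hgood] with σ hσ hσgood t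
  have h := D'.unique (fun u => D.flow u σ) (fun u => by rw [hcar]; exact hσgood u)
    (D.isSolution σ hσ) t
  simpa only [D.flow_zero σ hσ] using h

/-- Laplace integrability on `(0, ∞)` of a continuous function with a polynomial bound `K(1+t)^n`. [folklore] -/
theorem integrableOn_exp_neg_mul_of_abs_le_poly {g : ℝ → ℝ} (hg : Continuous g) {K : ℝ} {n : ℕ}
    (hb : ∀ t : ℝ, 0 ≤ t → |g t| ≤ K * (1 + t) ^ n) {ν : ℝ} (hν : 0 < ν) :
    IntegrableOn (fun t : ℝ => Real.exp (-(ν * t)) * g t) (Ioi 0) := by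
  have hcont : ContinuousOn (fun t : ℝ => Real.exp (-(ν * t)) * g t) (Ici 0) :=
    (Continuous.mul (by fun_prop) hg).continuousOn
  have h1 : g =O[atTop] fun t : ℝ => t ^ n := by
    refine Asymptotics.IsBigO.of_bound (|K| * 2 ^ n) ?_
    filter_upwards [eventually_ge_atTop (1 : ℝ)] with t ht
    rw [Real.norm_eq_abs, Real.norm_eq_abs, abs_of_nonneg (pow_nonneg (by linarith : (0:ℝ) ≤ t) n)]
    have h2t : (1 + t) ^ n ≤ (2 * t) ^ n := pow_le_pow_left₀ (by linarith) (by linarith) n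
    calc |g t| ≤ K * (1 + t) ^ n := hb t (by linarith)
      _ ≤ |K| * (1 + t) ^ n := mul_le_mul_of_nonneg_right (le_abs_self K) (pow_nonneg (by linarith) n)
      _ ≤ |K| * (2 * t) ^ n := mul_le_mul_of_nonneg_left h2t (abs_nonneg K)
      _ = |K| * 2 ^ n * t ^ n := by rw [mul_pow]; ring
  have h2 : (fun t : ℝ => t ^ n) =o[atTop] fun t : ℝ => Real.exp (ν / 2 * t) :=
    isLittleO_pow_exp_pos_mul_atTop n (half_pos hν)
  have h3 : g =O[atTop] fun t : ℝ => Real.exp (ν / 2 * t) := h1.trans h2.isBigO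
  have h4 : (fun t : ℝ => Real.exp (-(ν * t))) =O[atTop] fun t : ℝ => Real.exp (-(ν * t)) :=
    Asymptotics.isBigO_refl _ _
  have ho : (fun t : ℝ => Real.exp (-(ν * t)) * g t) =O[atTop] fun t : ℝ => Real.exp (-(ν / 2) * t) :=
    (h4.mul h3).congr_right fun t => by
      rw [← Real.exp_add]
      congr 1
      ring
  exact integrable_of_isBigO_exp_neg (half_pos hν) hcont ho

/-- Weierstrass M-test on time windows: a series of continuous functions with a summable majorant on every window
`|t| ≤ τ` has a continuous sum. [folklore] -/
theorem continuous_tsum_of_window_majorant {f : ℤ → ℝ → ℝ} (hf : ∀ x, Continuous (f x))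
    (hmaj : ∀ τ : ℝ, 0 ≤ τ → ∃ m : ℤ → ℝ, Summable m ∧ ∀ t : ℝ, |t| ≤ τ → ∀ x : ℤ, |f x t| ≤ m x) :
    Continuous fun t : ℝ => ∑' x : ℤ, f x t := by
  refine continuous_iff_continuousAt.2 fun t₀ => ?_
  obtain ⟨m, hm, hb⟩ := hmaj (|t₀| + 1) (by positivity)
  have hon : ContinuousOn (fun t : ℝ => ∑' x : ℤ, f x t) (Set.Ioo (-(|t₀| + 1)) (|t₀| + 1)) :=
    continuousOn_tsum (fun x => (hf x).continuousOn) hm fun x t ht => by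
      rw [Real.norm_eq_abs]; exact hb t (abs_le.2 ⟨ht.1.le, ht.2.le⟩) x
  exact hon.continuousAt (Ioo_mem_nhds (by linarith [neg_abs_le t₀]) (by linarith [le_abs_self t₀]))

/-- Orthogonality of the modes `cos(k·x)`, `x ∈ ℤ`, on `[−π, π]`: termwise integration of an absolutely summable
cosine series picks out `2π·c 0` (as in `Lines/birth.lean`). [folklore] -/
theorem integral_cosSeries_eq (c : ℤ → ℝ) (hc : Summable fun x : ℤ => |c x|) :
    ∫ k in (-Real.pi)..Real.pi, ∑' x : ℤ, Real.cos (k * (x : ℝ)) * c x = 2 * Real.pi * c 0 := by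
  have hmode : ∀ x : ℤ, ∫ k in (-Real.pi)..Real.pi, Real.cos (k * (x : ℝ)) * c x
      = if x = 0 then 2 * Real.pi * c 0 else 0 := by
    intro x
    rw [intervalIntegral.integral_mul_const]
    split_ifs with hx
    · subst hx
      simp only [Int.cast_zero, mul_zero, Real.cos_zero, intervalIntegral.integral_const, smul_eq_mul, mul_one]
      ring
    · have hx' : (x : ℝ) ≠ 0 := by exact_mod_cast hx
      have h1 : Real.sin (Real.pi * (x : ℝ)) = 0 := by
        rw [mul_comm]; exact Real.sin_int_mul_pi x
      have h2 : Real.sin (-Real.pi * (x : ℝ)) = 0 := by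
        rw [neg_mul, Real.sin_neg, h1, neg_zero]
      rw [intervalIntegral.integral_comp_mul_right Real.cos hx', integral_cos, h1, h2]
      simp
  have hbd : ∀ (x : ℤ) (k : ℝ), ‖Real.cos (k * (x : ℝ)) * c x‖ ≤ |c x| := fun x k => by
    rw [Real.norm_eq_abs, abs_mul]
    exact mul_le_of_le_one_left (abs_nonneg _) (Real.abs_cos_le_one _)
  have hsum : HasSum (fun x : ℤ => ∫ k in (-Real.pi)..Real.pi, Real.cos (k * (x : ℝ)) * c x)
      (∫ k in (-Real.pi)..Real.pi, ∑' x : ℤ, Real.cos (k * (x : ℝ)) * c x) := by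
    refine intervalIntegral.hasSum_integral_of_dominated_convergence (fun x _ => |c x|)
      (fun x => ?_) (fun x => ?_) ?_ ?_ ?_
    · exact ((Real.continuous_cos.comp (continuous_id.mul continuous_const)).mul
        continuous_const).aestronglyMeasurable
    · exact Eventually.of_forall fun k _ => hbd x k
    · exact Eventually.of_forall fun k _ => hc
    · exact intervalIntegrable_const
    · exact Eventually.of_forall fun k _ => (Summable.of_norm_bounded hc (fun x => hbd x k)).hasSum
  have hite : HasSum (fun x : ℤ => if x = 0 then 2 * Real.pi * c 0 else (0 : ℝ))
      (∫ k in (-Real.pi)..Real.pi, ∑' x : ℤ, Real.cos (k * (x : ℝ)) * c x) := by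
    simp only [hmode] at hsum
    exact hsum
  exact hite.unique (hasSum_ite_eq (0 : ℤ) (2 * Real.pi * c 0))

/-- From a weighted `tsum` bound to the bound on one term. [folklore] -/
theorem abs_le_of_weighted_tsum_le {a : ℤ → ℝ} {B : ℝ} (hs : Summable fun x : ℤ => (1 + (x : ℝ) ^ 2) * |a x|)
    (hb : (∑' x : ℤ, (1 + (x : ℝ) ^ 2) * |a x|) ≤ B) (x : ℤ) : |a x| ≤ B := by
  have h1 : |a x| ≤ (1 + (x : ℝ) ^ 2) * |a x| :=
    le_mul_of_one_le_left (abs_nonneg _) (by nlinarith [sq_nonneg (x : ℝ)])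
  have h2 : (1 + (x : ℝ) ^ 2) * |a x| ≤ ∑' y : ℤ, (1 + (y : ℝ) ^ 2) * |a y| :=
    hs.le_tsum x fun y _ => by positivity
  linarith

/-- Summability of `|a|` from the weighted summability. [folklore] -/
theorem summable_abs_of_weighted {a : ℤ → ℝ} (hs : Summable fun x : ℤ => (1 + (x : ℝ) ^ 2) * |a x|) :
    Summable fun x : ℤ => |a x| :=
  Summable.of_nonneg_of_le (fun x => abs_nonneg _)
    (fun x => le_mul_of_one_le_left (abs_nonneg _) (by nlinarith [sq_nonneg (x : ℝ)])) hs

/-! ### The composition (kernel-checked, no `sorry`): the six stubs give the crux BY NAME -/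

/-- `A → W1 → W2 → P → B → I → FibreCalculus`. Rigidity first (`flow_ae_eq_canonical`): the given guarded `D` and the
canonical `D♭` of `exists_bmDynamics` have the same `S`, `G`; W1 for `h₀`, `j₀` and W2 in the ρ-mixing transfer-operator
state (which `μ` is, by DLR uniqueness) give window majorants with `Σ_x (1+x²)(|S|+|G|) ≤ A(1+|t|)^m`, hence (1), (2),
(3), (4), (10) (continuity by the M-test and the tree's two-point continuity); A gives (5), (6); B gives (8); P and I
give (11), (12); (7) = (11) at `k = 0`; (9) is `integral_cosSeries_eq`. [folklore] -/
theorem FibreCalculus_of (hA : Registered.stub_staticStructureFactor)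
    (hW1 : Registered.stub_polynomialHorizonCone) (hW2 : Registered.stub_weightedClusteringTransfer)
    (hPst : Registered.stub_twiceIntegratedContinuity)
    (hB : Registered.stub_bochnerPositivity) (hI : Registered.stub_conservationLawIdentities) :
    FibreCalculus := by
  intro ω₂ lam β γ hω hl hβ T hT μ hG hSI hRefl D hP _hShift h hh S hS Sb hSb G hGd Gh hGh fh hfh χk hχk
  /- §0 chain data, superstability, the canonical dynamics, rigidity -/
  have hss : (pinnedChain ω₂ lam β γ).HasSuperstabilityEstimate μ :=
    OscillatorChain.hasSuperstabilityEstimate_of_isShiftInvariant_pinnedChain γ hω hl.le hβ.le hT hG hSI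
  haveI : IsProbabilityMeasure μ := hss.1
  have hU0 : ∀ q : ℝ, 0 ≤ (pinnedChain ω₂ lam β γ).U q := OscillatorChain.pinnedChain_U_nonneg β γ hω.le hl.le
  have hV0 : ∀ r : ℝ, 0 ≤ (pinnedChain ω₂ lam β γ).V r := OscillatorChain.pinnedChain_V_nonneg ω₂ lam γ hβ.le
  have hUm : Measurable (pinnedChain ω₂ lam β γ).U := OscillatorChain.measurable_pinnedChain_U ω₂ lam β γ
  have hVm : Measurable (pinnedChain ω₂ lam β γ).V := OscillatorChain.measurable_pinnedChain_V ω₂ lam β γ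
  have hU2 : OscillatorChain.IsEvenPolyOfDegree (pinnedChain ω₂ lam β γ).U 2 :=
    OscillatorChain.pinnedChain_isEvenPolyOfDegree_U β γ hω.le hl
  have hV2 : OscillatorChain.IsEvenPolyOfDegree (pinnedChain ω₂ lam β γ).V 2 :=
    OscillatorChain.pinnedChain_isEvenPolyOfDegree_V ω₂ lam γ hβ
  obtain ⟨D', hcar, hmeas, hid, -, -, -, hpresAll⟩ :=
    OscillatorChain.exists_bmDynamics (P := pinnedChain ω₂ lam β γ) one_le_two one_le_two hU2 hV2
  have hP' : D'.PreservesMeasure μ := hpresAll T μ hG hss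
  have hrig := flow_ae_eq_canonical γ hω hl hβ hT hG hSI D D' hP hcar
  have hφ : ∀ (t : ℝ) (x : ℤ) (σ : ChainConfig), D'.flow t (chainShift x σ) = chainShift x (D'.flow t σ) :=
    fun t x σ => D'.flow_chainShift_of_eq_id hcar hid hU0 hV0 t x σ
  have hτ : ∀ x : ℤ, MeasurePreserving (chainShift x) μ μ := hSI.measurePreserving_chainShift
  /- §1 the objects of `D` are the objects of `D♭` -/
  have hh' : ∀ (σ : ChainConfig) (x : ℤ), h σ x = (pinnedChain ω₂ lam β γ).energyDensityZ σ x := by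
    intro σ x; subst hh; rfl
  have hS' : S = fun (x : ℤ) (t : ℝ) =>
      ∫ σ, (h σ 0 - ∫ σ', h σ' 0 ∂μ) * (h (D'.flow t σ) x - ∫ σ', h σ' 0 ∂μ) ∂μ := by
    subst hS
    funext x t
    refine integral_congr_ae ?_
    filter_upwards [hrig] with σ hσ
    rw [hσ t]
  have hG' : G = fun (x : ℤ) (t : ℝ) => ∫ σ, (pinnedChain ω₂ lam β γ).bondCurrentZ σ 0 *
      (pinnedChain ω₂ lam β γ).bondCurrentZ (D'.flow t σ) x ∂μ := by
    subst hGd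
    funext x t
    refine integral_congr_ae ?_
    filter_upwards [hrig] with σ hσ
    rw [hσ t]
  have hCG : ∀ t : ℝ, D.currentCorrelation μ t = ∑' x : ℤ, G x t := by
    intro t; subst hGd; rfl
  /- §2 the ρ-mixing transfer-operator state: `μ` IS it (DLR uniqueness among shift-invariant states) -/
  obtain ⟨μ', hGμ', hSμ', -, -, C, mm, hmm, hmix⟩ :=
    Summit.AtomisticToContinuum.FouriersLaw.Theorems.MourreDissolution.exists_gibbsState_mixing_pinnedChain
      ω₂ lam β γ hω hl.le hβ.le T hT
  have hμμ' : μ = μ' :=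
    OscillatorChain.eq_of_isChainGibbsMeasure_of_isShiftInvariant_pinnedChain γ hω hl.le hβ.le hT hG hSI hGμ' hSμ'
  subst hμμ'
  /- §3 the two generators `h₀`, `j₀` -/
  set h0 : ChainConfig → ℝ := fun σ => (pinnedChain ω₂ lam β γ).energyDensityZ σ 0 with h0def
  set j0 : ChainConfig → ℝ := fun σ => (pinnedChain ω₂ lam β γ).bondCurrentZ σ 0 with j0def
  have h0m : Measurable h0 := (pinnedChain ω₂ lam β γ).measurable_energyDensityZ hUm hVm 0
  have j0m : Measurable j0 := measurable_bondCurrentZ _ 0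
  have h0d : DependsOn h0 (Set.Icc (-1 : ℤ) 1) := OscillatorChain.dependsOn_energyDensityZ_zero _
  have j0d : DependsOn j0 (Set.Icc (-1 : ℤ) 1) := OscillatorChain.dependsOn_bondCurrentZ_zero _
  have h02 : MemLp h0 2 μ := hss.memLp_energyDensityZ hU0 hV0 hUm hVm 0 ENNReal.ofNat_ne_top
  have j02 : MemLp j0 2 μ := hss.memLp_bondCurrentZ one_le_two hU0 hUm hV2 0 ENNReal.ofNat_ne_top
  have h04 : Integrable (fun σ => h0 σ ^ 4) μ := hss.integrable_energyDensityZ_pow_four hU0 hV0 hUm hVm 0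
  have j04 : Integrable (fun σ => j0 σ ^ 4) μ := hss.integrable_bondCurrentZ_pow_four one_le_two hU0 hUm hV2 0
  obtain ⟨Ch, hCh, hLh⟩ := OscillatorChain.exists_polyLipschitz_energyDensityZ hU2 hV2
  obtain ⟨Cj, hCj, hLj⟩ := OscillatorChain.exists_polyLipschitz_bondCurrentZ (P := pinnedChain ω₂ lam β γ) hV2
  /- §4 W1: polynomial-horizon cones for `h₀`, `j₀` -/
  obtain ⟨Ah, mh, hconeH⟩ := hW1 ω₂ lam β γ hω hl hβ T hT μ hG hSI D' hcar hmeas h0 h0m h0d h02 h04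
    Ch (2 * 2 + 2 * 2 + 1) hCh hLh
  obtain ⟨Aj, mj, hconeJ⟩ := hW1 ω₂ lam β γ hω hl hβ T hT μ hG hSI D' hcar hmeas j0 j0m j0d j02 j04
    Cj (2 * 2 + 1) hCj hLj
  /- §5 W2: weighted clustering transfer for `h₀`, `j₀` -/
  have h0d' : DependsOn h0 (Set.Icc (-((1 : ℕ) : ℤ)) (1 : ℕ)) := by simpa using h0d
  have j0d' : DependsOn j0 (Set.Icc (-((1 : ℕ) : ℤ)) (1 : ℕ)) := by simpa using j0d
  obtain ⟨Bh, hBh⟩ := hW2 μ inferInstance C mm hmm hmix hτ h0 1 h0d' h0m h02 1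
    (Real.sqrt (∫ σ, h0 σ ^ 2 ∂μ)) (Real.sqrt_nonneg _)
  obtain ⟨Bj, hBj⟩ := hW2 μ inferInstance C mm hmm hmix hτ j0 1 j0d' j0m j02 1
    (Real.sqrt (∫ σ, j0 σ ^ 2 ∂μ)) (Real.sqrt_nonneg _)
  /- §6 `S`, `G` as translated covariances -/
  have hmeanH : ∀ (t : ℝ) (x : ℤ), ∫ σ, ((h0 ∘ D'.flow t) ∘ chainShift x) σ ∂μ = ∫ σ, h0 σ ∂μ := by
    intro t x
    have e1 : ∫ σ, ((h0 ∘ D'.flow t) ∘ chainShift x) σ ∂μ = ∫ σ, (h0 ∘ D'.flow t) σ ∂μ :=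
      integral_comp_eq_of_measurePreserving (hτ x) (h0m.comp (hmeas t))
    rw [e1]
    exact integral_comp_eq_of_measurePreserving (hP'.2 t) h0m
  have hScov : ∀ (x : ℤ) (t : ℝ), S x t = cov[h0, (h0 ∘ D'.flow t) ∘ chainShift x; μ] := by
    intro x t
    rw [hS']
    simp only [covariance, hmeanH t x]
    refine integral_congr_ae (Eventually.of_forall fun σ => ?_)
    simp only [comp_apply, hφ t x σ, h0def, hh', OscillatorChain.energyDensityZ_chainShift, zero_add]
  have hmeanJ : ∫ σ, j0 σ ∂μ = 0 := hG.integral_bondCurrentZ_eq_zero 0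
  have hGcov : ∀ (x : ℤ) (t : ℝ), G x t = cov[j0, (j0 ∘ D'.flow t) ∘ chainShift x; μ] := by
    intro x t
    have hY2 : MemLp ((j0 ∘ D'.flow t) ∘ chainShift x) 2 μ :=
      (j02.comp_measurePreserving (hP'.2 t)).comp_measurePreserving (hτ x)
    rw [covariance_eq_sub j02 hY2, hmeanJ, zero_mul, sub_zero, hG']
    refine integral_congr_ae (Eventually.of_forall fun σ => ?_)
    simp only [Pi.mul_apply, comp_apply, hφ t x σ, j0def, OscillatorChain.bondCurrentZ_chainShift, zero_add]
  /- §7 window majorants with polynomial weighted sums -/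
  have hIcc : ∀ n : ℕ, Set.Icc (-((n + 1 : ℕ) : ℤ)) ((n + 1 : ℕ) : ℤ) = Set.Icc (-(n : ℤ) - 1) ((n : ℤ) + 1) := by
    intro n; push_cast; ring_nf
  have hwin : ∀ (a : ChainConfig → ℝ) (ham : Measurable a) (ha2 : MemLp a 2 μ) (A : ℝ) (m : ℕ) (B : ℝ),
      (∀ τ : ℝ, 0 ≤ τ → ∃ ε : ℕ → ℝ, (∀ n, 0 ≤ ε n) ∧
        Summable (fun n : ℕ => (1 + (n : ℝ)) ^ 2 * ε n) ∧
        (∑' n : ℕ, (1 + (n : ℝ)) ^ 2 * ε n) ≤ A * (1 + τ) ^ m ∧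
        ∀ t : ℝ, |t| ≤ τ → ∀ n : ℕ, ∃ g : ChainConfig → ℝ,
          DependsOn g (Set.Icc (-(n : ℤ) - 1) (n + 1)) ∧ Measurable g ∧ MemLp g 2 μ ∧
          Real.sqrt (∫ σ, (a (D'.flow t σ) - g σ) ^ 2 ∂μ) ≤ ε n) →
      (∀ ε : ℕ → ℝ, (∀ n, 0 ≤ ε n) → Summable (fun n : ℕ => (1 + (n : ℝ)) ^ 2 * ε n) →
        ∃ F : ℤ → ℝ, Summable (fun x : ℤ => (1 + (x : ℝ) ^ 2) * F x) ∧
          (∑' x : ℤ, (1 + (x : ℝ) ^ 2) * F x) ≤ B * (1 + ∑' n : ℕ, (1 + (n : ℝ)) ^ 2 * ε n) ∧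
          ∀ g : ChainConfig → ℝ, Measurable g → MemLp g 2 μ →
            Real.sqrt (∫ σ, g σ ^ 2 ∂μ) ≤ Real.sqrt (∫ σ, a σ ^ 2 ∂μ) →
            (∀ n : ℕ, ∃ h : ChainConfig → ℝ, DependsOn h (Set.Icc (-((n + 1 : ℕ) : ℤ)) (n + 1 : ℕ)) ∧
              Measurable h ∧ MemLp h 2 μ ∧ Real.sqrt (∫ σ, (g σ - h σ) ^ 2 ∂μ) ≤ ε n) →
            ∀ x : ℤ, |cov[a, g ∘ chainShift x; μ]| ≤ F x) →
      ∀ τ : ℝ, 0 ≤ τ → ∃ F : ℤ → ℝ, (∀ x, 0 ≤ F x) ∧ Summable (fun x : ℤ => (1 + (x : ℝ) ^ 2) * F x) ∧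
        (∑' x : ℤ, (1 + (x : ℝ) ^ 2) * F x) ≤ |B| * (1 + A) * (1 + τ) ^ m ∧
        ∀ t : ℝ, |t| ≤ τ → ∀ x : ℤ, |cov[a, (a ∘ D'.flow t) ∘ chainShift x; μ]| ≤ F x := by
    intro a ham ha2 A m B hcone htrans τ hτ0
    obtain ⟨ε, hε0, hεs, hεb, happ⟩ := hcone τ hτ0
    obtain ⟨F, hFs, hFb, hcov⟩ := htrans ε hε0 hεs
    have hbound : ∀ t : ℝ, |t| ≤ τ → ∀ x : ℤ, |cov[a, (a ∘ D'.flow t) ∘ chainShift x; μ]| ≤ F x := by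
      intro t ht x
      refine hcov (a ∘ D'.flow t) (ham.comp (hmeas t)) (ha2.comp_measurePreserving (hP'.2 t)) ?_ ?_ x
      · exact (Real.sqrt_le_sqrt (integral_sq_comp_eq' (hP'.2 t) ham).le)
      · intro n
        obtain ⟨g, hgd, hgm, hg2, hge⟩ := happ t ht n
        refine ⟨g, ?_, hgm, hg2, hge⟩
        rw [hIcc n]
        exact hgd
    have hF0 : ∀ x, 0 ≤ F x := fun x => (abs_nonneg _).trans (hbound 0 (by rw [abs_zero]; exact hτ0) x)
    have hE0 : 0 ≤ ∑' n : ℕ, (1 + (n : ℝ)) ^ 2 * ε n := tsum_nonneg fun n => mul_nonneg (by positivity) (hε0 n)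
    have hA0 : 0 ≤ A * (1 + τ) ^ m := hE0.trans hεb
    refine ⟨F, hF0, hFs, hFb.trans ?_, hbound⟩
    have h1τ : (1 : ℝ) ≤ (1 + τ) ^ m := one_le_pow₀ (by linarith)
    calc B * (1 + ∑' n : ℕ, (1 + (n : ℝ)) ^ 2 * ε n)
        ≤ |B| * (1 + ∑' n : ℕ, (1 + (n : ℝ)) ^ 2 * ε n) :=
          mul_le_mul_of_nonneg_right (le_abs_self B) (by linarith)
      _ ≤ |B| * (1 + A * (1 + τ) ^ m) := mul_le_mul_of_nonneg_left (by linarith) (abs_nonneg B)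
      _ ≤ |B| * ((1 + A) * (1 + τ) ^ m) := by
          refine mul_le_mul_of_nonneg_left ?_ (abs_nonneg B)
          nlinarith
      _ = |B| * (1 + A) * (1 + τ) ^ m := by ring
  have hwinS := hwin h0 h0m h02 Ah mh Bh hconeH hBh
  have hwinG := hwin j0 j0m j02 Aj mj Bj hconeJ hBj
  /- §8 pointwise-in-time consequences -/
  have hSt : ∀ t : ℝ, Summable (fun x : ℤ => (1 + (x : ℝ) ^ 2) * |S x t|) ∧
      (∑' x : ℤ, (1 + (x : ℝ) ^ 2) * |S x t|) ≤ |Bh| * (1 + Ah) * (1 + |t|) ^ mh := by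
    intro t
    obtain ⟨F, hF0, hFs, hFb, hb⟩ := hwinS |t| (abs_nonneg t)
    have hle : ∀ x : ℤ, (1 + (x : ℝ) ^ 2) * |S x t| ≤ (1 + (x : ℝ) ^ 2) * F x := fun x => by
      rw [hScov x t]
      exact mul_le_mul_of_nonneg_left (hb t le_rfl x) (by positivity)
    have hs : Summable (fun x : ℤ => (1 + (x : ℝ) ^ 2) * |S x t|) :=
      Summable.of_nonneg_of_le (fun x => by positivity) hle hFs
    exact ⟨hs, (hs.tsum_le_tsum hle hFs).trans hFb⟩
  have hGt : ∀ t : ℝ, Summable (fun x : ℤ => (1 + (x : ℝ) ^ 2) * |G x t|) ∧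
      (∑' x : ℤ, (1 + (x : ℝ) ^ 2) * |G x t|) ≤ |Bj| * (1 + Aj) * (1 + |t|) ^ mj := by
    intro t
    obtain ⟨F, hF0, hFs, hFb, hb⟩ := hwinG |t| (abs_nonneg t)
    have hle : ∀ x : ℤ, (1 + (x : ℝ) ^ 2) * |G x t| ≤ (1 + (x : ℝ) ^ 2) * F x := fun x => by
      rw [hGcov x t]
      exact mul_le_mul_of_nonneg_left (hb t le_rfl x) (by positivity)
    have hs : Summable (fun x : ℤ => (1 + (x : ℝ) ^ 2) * |G x t|) :=
      Summable.of_nonneg_of_le (fun x => by positivity) hle hFs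
    exact ⟨hs, (hs.tsum_le_tsum hle hFs).trans hFb⟩
  -- window majorants of `G` without weight (for the M-test)
  have hGmaj : ∀ τ : ℝ, 0 ≤ τ → ∃ m : ℤ → ℝ, Summable m ∧ ∀ t : ℝ, |t| ≤ τ → ∀ x : ℤ, |G x t| ≤ m x := by
    intro τ hτ0
    obtain ⟨F, hF0, hFs, -, hb⟩ := hwinG τ hτ0
    refine ⟨F, Summable.of_nonneg_of_le hF0 (fun x => ?_) hFs, fun t ht x => ?_⟩
    · exact le_mul_of_one_le_left (hF0 x) (by nlinarith [sq_nonneg (x : ℝ)])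
    · rw [hGcov x t]; exact hb t ht x
  /- §9 continuity in time -/
  have hScont : ∀ x : ℤ, Continuous (S x) := by
    intro x
    have hc := InfiniteChainDynamics.continuous_integral_energyDensityZ_mul_flow_pinnedChain γ hω.le hl.le hβ
      hss D' hP' x 0
    have e : S x = fun t : ℝ => (∫ σ, (pinnedChain ω₂ lam β γ).energyDensityZ σ 0 *
        (pinnedChain ω₂ lam β γ).energyDensityZ (D'.flow t σ) x ∂μ) - (∫ σ, h0 σ ∂μ) * ∫ σ, h0 σ ∂μ := by
      funext t
      have hY2 : MemLp ((h0 ∘ D'.flow t) ∘ chainShift x) 2 μ :=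
        (h02.comp_measurePreserving (hP'.2 t)).comp_measurePreserving (hτ x)
      rw [hScov x t, covariance_eq_sub h02 hY2, hmeanH t x]
      congr 1
      refine integral_congr_ae (Eventually.of_forall fun σ => ?_)
      simp only [Pi.mul_apply, comp_apply, hφ t x σ, h0def, OscillatorChain.energyDensityZ_chainShift, zero_add]
    rw [e]
    exact hc.sub continuous_const
  have hGcont : ∀ x : ℤ, Continuous (G x) := by
    intro x
    rw [hG']
    exact InfiniteChainDynamics.continuous_integral_bondCurrentZ_mul_flow_pinnedChain γ hω.le hl.le hβ hss D' hP' x 0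
  have hCcont : Continuous fun t : ℝ => ∑' x : ℤ, G x t :=
    continuous_tsum_of_window_majorant hGcont hGmaj
  have hCkcont : ∀ k : ℝ, Continuous fun t : ℝ => ∑' x : ℤ, Real.cos (k * (x : ℝ)) * G x t := by
    intro k
    refine continuous_tsum_of_window_majorant (f := fun x t => Real.cos (k * (x : ℝ)) * G x t)
      (fun x => continuous_const.mul (hGcont x)) fun τ hτ0 => ?_
    obtain ⟨m, hm, hb⟩ := hGmaj τ hτ0
    refine ⟨m, hm, fun t ht x => ?_⟩
    rw [abs_mul]
    exact (mul_le_of_le_one_left (abs_nonneg _) (Real.abs_cos_le_one _)).trans (hb t ht x)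
  /- §10 the clauses -/
  -- (3)
  have h3 : ∀ x : ℤ, ∀ ν : ℝ, 0 < ν → IntegrableOn (fun t : ℝ => Real.exp (-(ν * t)) * S x t) (Ioi 0) := by
    intro x ν hν
    refine integrableOn_exp_neg_mul_of_abs_le_poly (hScont x) (K := |Bh| * (1 + Ah)) (n := mh) ?_ hν
    intro t ht
    have h := abs_le_of_weighted_tsum_le (hSt t).1 (hSt t).2 x
    rwa [abs_of_nonneg ht] at h
  -- (4)
  have h4 : ∀ ν : ℝ, 0 < ν → Summable (fun x : ℤ => (1 + (x : ℝ) ^ 2) * |Sb ν x|) := by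
    intro ν hν
    set K : ℝ := |Bh| * (1 + Ah) with hK
    have hpoly : Continuous fun t : ℝ => K * (1 + t) ^ mh := by fun_prop
    have hmajI : IntegrableOn (fun t : ℝ => Real.exp (-(ν * t)) * (K * (1 + t) ^ mh)) (Ioi 0) :=
      integrableOn_exp_neg_mul_of_abs_le_poly hpoly (K := |K|) (n := mh)
        (fun t ht => by rw [abs_mul, abs_of_nonneg (pow_nonneg (by linarith : (0:ℝ) ≤ 1 + t) mh)]) hν
    refine summable_of_sum_le (fun x => by positivity) (c := ν * ∫ t in Ioi (0:ℝ),
      Real.exp (-(ν * t)) * (K * (1 + t) ^ mh)) fun u => ?_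
    have hterm : ∀ x ∈ u, (1 + (x : ℝ) ^ 2) * |Sb ν x| ≤
        ν * ∫ t in Ioi (0:ℝ), Real.exp (-(ν * t)) * ((1 + (x : ℝ) ^ 2) * |S x t|) := by
      intro x _
      rw [hSb]
      dsimp only
      rw [abs_mul, abs_of_pos hν, mul_left_comm]
      refine mul_le_mul_of_nonneg_left ?_ hν.le
      have h1 : |∫ t in Ioi (0:ℝ), Real.exp (-(ν * t)) * S x t| ≤
          ∫ t in Ioi (0:ℝ), |Real.exp (-(ν * t)) * S x t| := abs_integral_le_integral_abs
      have h2 : ∫ t in Ioi (0:ℝ), |Real.exp (-(ν * t)) * S x t| =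
          ∫ t in Ioi (0:ℝ), Real.exp (-(ν * t)) * |S x t| :=
        integral_congr_ae (Eventually.of_forall fun t => by
          simp only [abs_mul, abs_of_pos (Real.exp_pos _)])
      calc (1 + (x : ℝ) ^ 2) * |∫ t in Ioi (0:ℝ), Real.exp (-(ν * t)) * S x t|
          ≤ (1 + (x : ℝ) ^ 2) * ∫ t in Ioi (0:ℝ), Real.exp (-(ν * t)) * |S x t| := by
            refine mul_le_mul_of_nonneg_left (h1.trans_eq h2) (by positivity)
        _ = ∫ t in Ioi (0:ℝ), (1 + (x : ℝ) ^ 2) * (Real.exp (-(ν * t)) * |S x t|) :=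
            (integral_const_mul _ _).symm
        _ = ∫ t in Ioi (0:ℝ), Real.exp (-(ν * t)) * ((1 + (x : ℝ) ^ 2) * |S x t|) :=
            integral_congr_ae (Eventually.of_forall fun t => by ring)
    have hint : ∀ x : ℤ, IntegrableOn (fun t : ℝ => Real.exp (-(ν * t)) * ((1 + (x : ℝ) ^ 2) * |S x t|))
        (Ioi 0) := by
      intro x
      have h := ((h3 x ν hν).norm).const_mul (1 + (x : ℝ) ^ 2)
      refine h.congr (Eventually.of_forall fun t => ?_)
      simp only [Real.norm_eq_abs, abs_mul, abs_of_pos (Real.exp_pos _)]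
      ring
    calc ∑ x ∈ u, (1 + (x : ℝ) ^ 2) * |Sb ν x|
        ≤ ∑ x ∈ u, ν * ∫ t in Ioi (0:ℝ), Real.exp (-(ν * t)) * ((1 + (x : ℝ) ^ 2) * |S x t|) :=
          Finset.sum_le_sum hterm
      _ = ν * ∫ t in Ioi (0:ℝ), Real.exp (-(ν * t)) * ∑ x ∈ u, (1 + (x : ℝ) ^ 2) * |S x t| := by
          rw [← Finset.mul_sum, ← integral_finsetSum u (fun x _ => hint x)]
          congr 1
          refine integral_congr_ae (Eventually.of_forall fun t => ?_)
          simp only [Finset.mul_sum]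
      _ ≤ ν * ∫ t in Ioi (0:ℝ), Real.exp (-(ν * t)) * (K * (1 + t) ^ mh) := by
          refine mul_le_mul_of_nonneg_left ?_ hν.le
          refine setIntegral_mono_on (integrable_finsetSum u (fun x _ => hint x) |>.congr ?_) hmajI
            measurableSet_Ioi fun t ht => ?_
          · exact Eventually.of_forall fun t => by simp only [Finset.mul_sum]
          · refine mul_le_mul_of_nonneg_left ?_ (Real.exp_pos _).le
            have hs := (hSt t).1
            calc ∑ x ∈ u, (1 + (x : ℝ) ^ 2) * |S x t| ≤ ∑' x : ℤ, (1 + (x : ℝ) ^ 2) * |S x t| :=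
                  hs.sum_le_tsum u fun x _ => by positivity
              _ ≤ K * (1 + |t|) ^ mh := (hSt t).2
              _ = K * (1 + t) ^ mh := by rw [abs_of_pos (mem_Ioi.1 ht)]
  -- (5), (6): statics
  have hS0 : (fun x : ℤ => S x 0) =
      (fun x : ℤ => ∫ σ, (h σ 0 - ∫ σ', h σ' 0 ∂μ) * (h σ x - ∫ σ', h σ' 0 ∂μ) ∂μ) := by
    funext x
    rw [hS]
    refine integral_congr_ae ?_
    filter_upwards [hP.1] with σ hσ
    rw [D.flow_zero σ hσ]
  obtain ⟨h5, h6⟩ := hA ω₂ lam β γ hω hl hβ T hT μ hG hSI hRefl h hh (fun x : ℤ => S x 0) hS0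
  have h5' : Summable (fun x : ℤ => (1 + (x : ℝ) ^ 2) * |S x 0|) := by simpa using h5
  have hχ0 : χk 0 = ∑' x : ℤ, S x 0 := by simp only [hχk, zero_mul, Real.cos_zero, one_mul]
  have h6' : 0 < χk 0 := by rw [hχ0]; simpa using h6
  -- (8): Bochner
  have hSbabs : ∀ ν : ℝ, 0 < ν → Summable (fun x : ℤ => |Sb ν x|) := fun ν hν => summable_abs_of_weighted (h4 ν hν)
  have h8 : ∀ ν : ℝ, 0 < ν → ∀ k : ℝ, 0 ≤ fh ν k :=
    hB ω₂ lam β γ hω hl hβ T hT μ hG hSI hRefl D' hcar hmeas hid h hh S hS' Sb hSb h3 hSbabs fh hfh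
  -- (11), (12): the identities (stub P feeds stub I)
  have hPid := hPst ω₂ lam β γ hω hl hβ T hT μ hG hSI hRefl D' hcar hmeas hid h hh S hS' G hG'
  obtain ⟨MG, -, hMG⟩ := OscillatorChain.exists_abs_correlationTerm_le_pinnedChain γ hω.le hl.le hβ hss D' hP'
  have hMG' : ∃ M : ℝ, ∀ (x : ℤ) (t : ℝ), |G x t| ≤ M := ⟨MG, fun x t => by rw [hG']; exact hMG t x⟩
  obtain ⟨h11, h12'⟩ := hI S G hGcont hMG' ⟨|Bj| * (1 + Aj), mj, hGt⟩ hPid h3 Sb hSb h4 h5' Gh hGh fh hfh χk hχk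
  -- (10)
  have h10 : ∀ ν : ℝ, 0 < ν → ∀ k : ℝ,
      IntegrableOn (fun t : ℝ => Real.exp (-(ν * t)) * ∑' x : ℤ, Real.cos (k * (x : ℝ)) * G x t) (Ioi 0) := by
    intro ν hν k
    refine integrableOn_exp_neg_mul_of_abs_le_poly (hCkcont k) (K := |Bj| * (1 + Aj)) (n := mj) ?_ hν
    intro t ht
    have hs := (hGt t).1
    have habs : Summable fun x : ℤ => |G x t| := summable_abs_of_weighted hs
    have hcs : Summable fun x : ℤ => Real.cos (k * (x : ℝ)) * G x t :=
      Summable.of_norm_bounded habs fun x => by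
        rw [Real.norm_eq_abs, abs_mul]
        exact mul_le_of_le_one_left (abs_nonneg _) (Real.abs_cos_le_one _)
    calc |∑' x : ℤ, Real.cos (k * (x : ℝ)) * G x t| ≤ ∑' x : ℤ, |Real.cos (k * (x : ℝ)) * G x t| := by
          have := norm_tsum_le_tsum_norm hcs.norm
          simpa only [Real.norm_eq_abs] using this
      _ ≤ ∑' x : ℤ, (1 + (x : ℝ) ^ 2) * |G x t| := by
          refine Summable.tsum_le_tsum (fun x => ?_) hcs.abs hs
          rw [abs_mul]
          calc |Real.cos (k * (x : ℝ))| * |G x t| ≤ 1 * |G x t| :=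
                mul_le_mul_of_nonneg_right (Real.abs_cos_le_one _) (abs_nonneg _)
            _ ≤ (1 + (x : ℝ) ^ 2) * |G x t| :=
                mul_le_mul_of_nonneg_right (by nlinarith [sq_nonneg (x : ℝ)]) (abs_nonneg _)
      _ ≤ |Bj| * (1 + Aj) * (1 + |t|) ^ mj := (hGt t).2
      _ = |Bj| * (1 + Aj) * (1 + t) ^ mj := by rw [abs_of_nonneg ht]
  -- (1)
  have h1 : ∀ t : ℝ, D.HasAbsConvergentCorrelation μ t := by
    intro t
    refine ⟨fun x => hss.integrable_bondCurrentZ_mul_comp one_le_two hU0 hUm hV2 (hP.2 t) x 0, ?_⟩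
    have hs : Summable fun x : ℤ => |G x t| := summable_abs_of_weighted (hGt t).1
    refine hs.congr fun x => ?_
    rw [hGd]
  -- (2)
  have h2 : ∀ ν : ℝ, 0 < ν → IntegrableOn (fun t : ℝ => Real.exp (-(ν * t)) * D.currentCorrelation μ t) (Ioi 0) := by
    intro ν hν
    have e : (fun t : ℝ => Real.exp (-(ν * t)) * D.currentCorrelation μ t) =
        fun t : ℝ => Real.exp (-(ν * t)) * ∑' x : ℤ, Real.cos (0 * (x : ℝ)) * G x t := by
      funext t; simp only [hCG t, zero_mul, Real.cos_zero, one_mul]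
    rw [e]
    exact h10 ν hν 0
  -- (12)
  have h12 : ∀ ν : ℝ, 0 < ν → ∫ t in Ioi (0:ℝ), Real.exp (-(ν * t)) * D.currentCorrelation μ t =
      ν / 2 * ((∑' x : ℤ, (x : ℝ) ^ 2 * Sb ν x) - ∑' x : ℤ, (x : ℝ) ^ 2 * S x 0) := by
    intro ν hν
    simp only [hCG]
    exact h12' ν hν
  -- (7) from (11) at `k = 0`
  have h7 : ∀ ν : ℝ, 0 < ν → ∑' x : ℤ, Sb ν x = χk 0 := by
    intro ν hν
    have e := h11 ν hν 0
    have hf0 : fh ν 0 = ∑' x : ℤ, Sb ν x := by simp only [hfh, zero_mul, Real.cos_zero, one_mul]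
    rw [Real.cos_zero, hf0] at e
    have hz : (2 - 2 * (1 : ℝ)) * Gh ν 0 / ν = 0 := by ring
    linarith
  -- (9) Parseval at zero from (4)
  have h9 : ∀ ν : ℝ, 0 < ν → ∫ k in (-Real.pi)..Real.pi, fh ν k = 2 * Real.pi * Sb ν 0 := by
    intro ν hν
    simp only [hfh]
    exact integral_cosSeries_eq (Sb ν) (hSbabs ν hν)
  exact ⟨h1, h2, h3, h4, h5', h6', h7, h8, h9, h10, h11, h12⟩

/-- Type-check of the seam (an `example`, adds nothing to the environment): the sorried stubs are literally the
antecedents of `FibreCalculus_of`. -/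
example : FibreCalculus :=
  FibreCalculus_of stub_staticStructureFactor stub_polynomialHorizonCone stub_weightedClusteringTransfer
    stub_twiceIntegratedContinuity stub_bochnerPositivity stub_conservationLawIdentities

end Summit.AtomisticToContinuum.FouriersLaw.Cruxes.FibreCalculus.CanonicalReduction

end
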